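import Summits.BirchSwinnertonDyer.BirchSwinnertonDyer.Theorems.EisensteinPrimesBSDpOnCellCStubC3OneInequality
import Summits.BirchSwinnertonDyer.BirchSwinnertonDyer.Theorems.EisensteinPrimesBSDpOnCellCStubC3RoadHOther
import HarnessLib

/-!
# Crux 4 `BSDpOnCellC` (stmt-BirchSwinnertonDyer-19034), line b1 v10, stub `stub_c3`: WHAT EACH TYPED HALF
# BUYS ON THE INVARIANTS — road R-β alone gives the Euler-system bound `λ(X_ac^∅) ≤ λ(𝓛^BDP)`; the IMC
# atom c3♭′ plus `μ = 0` on EITHER side gives all of D′ (cell `bsd-eis`, seat `bsd-line-x2-p2` gen 2,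
# D-0154 KEY row 5; route `EisensteinPrimes`; companions p609918, p611576, c3h g4 `…StubC3RoadHOther`)

HONEST FRAMING (cell `bsd-eis`, run/shared/lean/pub/bsd-eis/): pure commutative algebra of `𝓞_{ℂ_p}⟦T⟧`
plus conditional re-statements on the binders of the typed halves of the IMC atom of line b1; everything
is PROVED from tree theorems; nothing about any curve is asserted; nothing booked; X2 stays
CONSTRUCTION-SHAPED; no label or count moves; BSD and the anticyclotomic main conjecture are proved for
no curve. Helper attached to stmt-BirchSwinnertonDyer-19034 (`--supports`), closes no stub.

## Why

`Theorems/…StubC3OtherLinks.lean` §2 (c3h g4) records that D′ at `𝔭̄` is NOT derivable from the typed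
Keller–Yin Thm. D (the ideal EQUALITY c3♭′ says nothing about `μ`). This file makes the two missing
bookkeeping arrows precise, in the module-invariant currency of p609918 (non-split sign; the split sign
is the same algebra and is left to the glue of p489067 / `…ResidualPub`):

* §1 algebra: `firstUnitCoeff_of_span_singleton_eq` — in the domain `𝓞_{ℂ_p}⟦T⟧`, `(F) = (L)` and `F`
  with first unit coefficient at `n` ⟹ `L` has its first unit coefficient at `n` (associates differ by
  a unit, whose constant term has norm `1`).
* §2 `lambdaInvariant_le_of_divIntOther` — ROAD R-β ALONE (the Kolyvagin divisibility
  `𝓕♭ ∣ p^k·Q` at `𝔭̄`), with `X_ac^∅` torsion from PUB ×4 (c3h g4 `isTorsion_xAc_other_of_cellC`) and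
  `μ(X_ac^∅) = 0`, gives `λ(X_ac^∅) ≤ m` for every index `m` at which the frame `Q` has its first unit
  coefficient: the Euler-system UPPER BOUND on the algebraic `λ` (p611576 `le_of_C_pow_mul_mem`).
* §3 `frame_shape_of_imcEq_of_mu_eq_zero` / `invariants_of_imcEq_of_frame_shape` — at a datum where the
  IMC atom `R1.IMCEqIntAt … 𝔭̄ … Q` holds: `μ(X_ac^∅) = 0` ⟹ `Q` has its first unit coefficient at
  `λ(X_ac^∅)` (so `μ(𝓛) = 0`, `λ(𝓛) = λ(X_ac^∅)`), and conversely a first unit coefficient of `Q` at `m`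
  ⟹ `μ(X_ac^∅) = 0 ∧ λ(X_ac^∅) = m`. Hence
  `nonsplitMuLambdaOnTreeIntOther_of_imcEq_of_mu_eq_zero` / `…_of_imcEq_of_frame_shape`: D′ at `𝔭̄`
  ⟸ c3♭′ + [`μ = 0` on ONE side] (+ PUB ×4 for torsion) — so «Thm. D (PRE) + Hsieh/Burungale-type
  analytic `μ = 0`» or «Thm. D + the `μ`-Lemma for `𝔛_f`» each yield D′, and D′ ∧ c3♭′ ⟺ c3♭′ ∧ [`μ = 0`
  on one side].

What this is NOT: not a proof of c3♭′, of R-β, or of any `μ = 0`; `stub_c3` is untouched.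

References: [Washington1997] §7.1 Prop. 7.2 / Thm. 7.3, §13.2; [KellerYin2024] §3, §5.1, Thm. 5.1.3
(arXiv:2402.12781v2, PRE — locator only); [Hsieh2014] Thm. B (analytic `μ`; context only, nothing taken);
cell: RULING L31, p489067, c3h g4 `…StubC3OtherLinks` §2, p609918, p611576.
-/

set_option autoImplicit false
set_option linter.dupNamespace false -- the summit namespace `…BirchSwinnertonDyer.BirchSwinnertonDyer.Theorems` (Sub = Summit, D-0017) trips it

noncomputable section

open scoped Classical MatrixGroups ModularForm

open CongruenceSubgroup WeierstrassCurve NumberField IsDedekindDomain Field PowerSeries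
  Literature.NumberTheory.EllipticCurves Literature.NumberTheory.EllipticCurves.GreenbergSelmer
  Literature.NumberTheory.EllipticCurves.GreenbergVatsal2000
  Literature.NumberTheory.EllipticCurves.ModularForms
  Literature.NumberTheory.EllipticCurves.Rank1Residual
  Literature.NumberTheory.EllipticCurves.Rank1Residual.Typed
  Literature.NumberTheory.GaloisRepresentations Literature.NumberTheory.GaloisCohomology
  Literature.NumberTheory.Automorphic
  Summit.BirchSwinnertonDyer.Rank1Residual.X11b.AcSelmer
  Summit.BirchSwinnertonDyer.Rank1Residual.X11b.Halves
  Summit.BirchSwinnertonDyer.Rank1Residual.X11b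
  Summit.BirchSwinnertonDyer.Rank1Residual Summit.BirchSwinnertonDyer.Rank1Residual.X1
  Summit.BirchSwinnertonDyer.Rank1Residual.X2
  Summit.BirchSwinnertonDyer.BirchSwinnertonDyer.Theorems.StubC3MuLambdaInvariants
  Summit.BirchSwinnertonDyer.BirchSwinnertonDyer.Theorems.StubC3OneInequality

namespace Summit.BirchSwinnertonDyer.BirchSwinnertonDyer.Theorems.StubC3InvariantTransfers

variable {p : ℕ} [Fact p.Prime]

/-! ### §1 Associates in `𝓞_{ℂ_p}⟦T⟧` have the same first-unit-coefficient index -/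

/-- A unit of `𝓞_{ℂ_p}⟦T⟧` has its first unit coefficient at `0` (its constant term is a unit of
`𝓞_{ℂ_p}`, of norm `1`). [folklore] -/
theorem firstUnitCoeff_zero_of_isUnit {u : PowerSeries 𝓞_ℂ_[p]} (hu : IsUnit u) :
    ‖((coeff 0 u : 𝓞_ℂ_[p]) : ℂ_[p])‖ = 1 ∧ ∀ i < 0, ‖((coeff i u : 𝓞_ℂ_[p]) : ℂ_[p])‖ < 1 := by
  refine ⟨?_, fun i hi ↦ (Nat.not_lt_zero i hi).elim⟩
  obtain ⟨u0, hu0⟩ := PowerSeries.isUnit_iff_constantCoeff.mp hu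
  rw [coeff_zero_eq_constantCoeff_apply, ← hu0]
  exact R1.norm_coe_units_padicComplexInt p u0

/-- **`(F) = (L)` transports the shape.** In the domain `𝓞_{ℂ_p}⟦T⟧`: if `(F) = (L)` and `F` has its
first unit coefficient at `n`, so does `L` (`L = F·u` with `u` a unit; indices add). [cite: Washington1997, §7.1 (Prop. 7.2, Thm. 7.3)] -/
theorem firstUnitCoeff_of_span_singleton_eq {F L : PowerSeries 𝓞_ℂ_[p]} {n : ℕ}
    (h : Ideal.span ({F} : Set (PowerSeries 𝓞_ℂ_[p])) = Ideal.span {L})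
    (hF : ‖((coeff n F : 𝓞_ℂ_[p]) : ℂ_[p])‖ = 1 ∧ ∀ i < n, ‖((coeff i F : 𝓞_ℂ_[p]) : ℂ_[p])‖ < 1) :
    ‖((coeff n L : 𝓞_ℂ_[p]) : ℂ_[p])‖ = 1 ∧ ∀ i < n, ‖((coeff i L : 𝓞_ℂ_[p]) : ℂ_[p])‖ < 1 := by
  obtain ⟨u, hu⟩ := Ideal.span_singleton_eq_span_singleton.mp h
  have := CpIntSeries.firstUnitCoeffAt_mul hF (firstUnitCoeff_zero_of_isUnit u.isUnit)
  rwa [hu, add_zero] at this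

/-! ### §2 Road R-β alone: the Euler-system bound `λ(X_ac^∅) ≤ λ(𝓛^BDP)` -/

section Datum

variable {W : WeierstrassCurve ℚ} [W.IsElliptic] [W.IsGloballyMinimal]

/-- **Road R-β ⟹ `λ(X_ac^∅ strict at 𝔭̄) ≤ λ(𝓛)`** (non-split X2c data). Given GZK, modularity,
Poitou–Tate ×2 (torsion of `X_ac^∅`, c3h g4 `isTorsion_xAc_other_of_cellC`) and `X2.NonsplitKolyvaginDivOnTreeIntOther W p`
(`𝓕♭ ∣ p^k·Q` at every datum): at every datum with `μ(X_ac^∅) = 0`, every index `m` at which the frame `Q`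
has its first unit coefficient satisfies `λ(X_ac^∅) ≤ m`. The upper bound on the algebraic `λ` is thus
the Kolyvagin half's content on invariants; equality needs the opposite bound (p611576). CONDITIONAL;
nothing booked. [claim: KellerYin2024, status: under-review]
[cite: KellerYin2024, §3 (the reducible Heegner-point Kolyvagin system) (arXiv:2402.12781v2) (shape only; nothing asserted)]
[cite: Washington1997, §13.2 and §7.1 Prop. 7.2] -/
theorem lambdaInvariant_le_of_divIntOther
    (hGZK : rank_eq_analyticRank_of_analyticRank_le_one) (hnf : exists_isNewformOf)
    (hPT : ∀ (K : Type) [Field K] [NumberField K], poitouTate_selmerStructure_duality K)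
    (hPT2 : ∀ (K : Type) [Field K] [NumberField K], poitouTate_sha_tateDual K)
    (hdiv : NonsplitKolyvaginDivOnTreeIntOther W p) :
    ∀ (N : ℕ) [NeZero N] (K : Type) [Field K] [NumberField K] (Dt : ModularParametrizationData W N)
        (H : HeegnerDatum N (NumberField.discr K)) (ιK : K →+* ℂ) (P : (W.baseChange K).toAffine.Point),
        CellC W p → ¬ W.HasSplitMultiplicativeReductionAtPrime p → W.conductorNorm ℤ = N →
        IsImaginaryQuadratic K → NumberField.discr K < -4 → SatisfiesHeegnerHypothesis N K →
        (W.quadraticTwist (NumberField.discr K : ℚ)).entireLFunction 1 ≠ 0 →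
        WeierstrassCurve.Affine.Point.map ιK.toRatAlgHom P = heegnerPointComplex Dt H →
        ¬ (p : ℤ) ∣ Dt.c → ¬ IsOfFinAddOrder P →
        Odd (NumberField.discr K) →
        ∀ (κ : ZpExtension K p), κ.IsAnticyclotomic →
          ∀ (γ : Field.absoluteGaloisGroup K) [Fact (κ.IsTopGenerator γ)]
            (𝔭 : HeightOneSpectrum (𝓞 K)), ((p : ℕ) : 𝓞 K) ∈ 𝔭.asIdeal →
            𝔭.asIdeal.ramificationIdx (𝓞 ℚ) = 1 → 𝔭.asIdeal.inertiaDeg (𝓞 ℚ) = 1 →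
            ∀ (𝔭bar : HeightOneSpectrum (𝓞 K)), ((p : ℕ) : 𝓞 K) ∈ 𝔭bar.asIdeal → 𝔭bar ≠ 𝔭 →
              ((Ideal.span {(p : ℤ)}).primesOver (𝓞 K)).ncard = 2 →
            ∀ (f : CuspForm (CongruenceSubgroup.Gamma0 N) 2), IsNewformOf W f →
              ∀ (ι' : PadicAlgCl p ≃+* ℂ),
                (∀ (w : InfinitePlace K) (k : 𝓞 K),
                  k ∈ 𝔭.asIdeal ↔ ‖ι'.symm (w.embedding (k : K))‖ < 1) →
                ∀ (ΩK : ℂ) (Ωp : ℂ_[p]) (Q : PowerSeries 𝓞_ℂ_[p]), ΩK ≠ 0 → ‖Ωp‖ = 1 →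
                  R1.IsBDPLFunctionInt p ι' 𝔭 κ γ f ΩK Ωp Q →
                    muInvariant p (XAc (W.baseChange K) p κ 𝔭bar ∅ γ) = 0 →
                      ∀ m : ℕ, (‖((PowerSeries.coeff m Q : 𝓞_ℂ_[p]) : ℂ_[p])‖ = 1 ∧
                      ∀ i < m, ‖((PowerSeries.coeff i Q : 𝓞_ℂ_[p]) : ℂ_[p])‖ < 1) →
                        lambdaInvariant p (XAc (W.baseChange K) p κ 𝔭bar ∅ γ) ≤ m := by
  intro N _ K _ _ Dt H ιK P hc hns hN hK hd4 hHN hLt hP hcM hPinf hodd κ hκ γ _ 𝔭 h𝔭 he hf 𝔭bar h𝔭bar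
    hne hsplit f hfW ι' hι' ΩK Ωp Q hΩK hΩp hQ hμ m hQm
  obtain ⟨F, hF⟩ :=
    (charIdeal_isPrincipal_holds p (XAc (W.baseChange K) p κ 𝔭bar ∅ γ)).principal
  have hchar : XAc.charIdeal (W.baseChange K) p κ 𝔭bar ∅ γ = Ideal.span {F} := hF
  obtain ⟨k, hk⟩ := hdiv N K Dt H ιK P hc hns hN hK hd4 hHN hLt hP hcM hPinf hodd κ hκ γ 𝔭 h𝔭 he
    hf 𝔭bar h𝔭bar hne hsplit f hfW ι' hι' ΩK Ωp Q hΩK hΩp hQ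
  haveI := module_finite_XAc_baseChange (W := W) p κ 𝔭bar γ
  have htor := (isTorsion_xAc_other_of_cellC hGZK hnf hPT hPT2 hc hK
        (fun q hq hqp ↦ hHN q hq (hqp.trans (hN ▸
          Summit.BirchSwinnertonDyer.Rank1Residual.X11b.dvd_conductorNorm_of_mult (W := W) hc.2.2.2)))
        hLt P hPinf κ hκ γ 𝔭bar h𝔭bar)
  have hFn := firstUnitCoeff_map_toCpInt_of_charIdeal_eq_span _ htor hμ hchar
  rw [hchar, Ideal.map_span, Set.image_singleton] at hk
  exact le_of_C_pow_mul_mem hk hFn hQm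

/-! ### §3 The IMC atom + `μ = 0` on either side ⟹ D′ -/

/-- **c3♭′ at a datum + `μ(X_ac^∅) = 0` ⟹ the frame has its first unit coefficient at `λ(X_ac^∅)`**
(so `μ(𝓛) = 0` and `λ(𝓛) = λ(X_ac^∅)`): on every binder of `X2.NonsplitIMCEqOnTreeIntOther W p`, from
the atom `R1.IMCEqIntAt W p κ 𝔭̄ γ Q`, torsion (PUB ×4) and `μ(X_ac^∅) = 0`, by §1. CONDITIONAL;
nothing booked. [claim: KellerYin2024, status: under-review]
[cite: KellerYin2024, Thm. 5.1.3 = Thm. D and §5.1 (the μ-Lemma) (arXiv:2402.12781v2) (shape only; nothing asserted)]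
[cite: Washington1997, §13.2 and §7.1 Prop. 7.2] -/
theorem frame_shape_of_imcEq_of_mu_eq_zero
    (hGZK : rank_eq_analyticRank_of_analyticRank_le_one) (hnf : exists_isNewformOf)
    (hPT : ∀ (K : Type) [Field K] [NumberField K], poitouTate_selmerStructure_duality K)
    (hPT2 : ∀ (K : Type) [Field K] [NumberField K], poitouTate_sha_tateDual K)
    (himc : NonsplitIMCEqOnTreeIntOther W p) :
    ∀ (N : ℕ) [NeZero N] (K : Type) [Field K] [NumberField K] (Dt : ModularParametrizationData W N)
        (H : HeegnerDatum N (NumberField.discr K)) (ιK : K →+* ℂ) (P : (W.baseChange K).toAffine.Point),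
        CellC W p → ¬ W.HasSplitMultiplicativeReductionAtPrime p → W.conductorNorm ℤ = N →
        IsImaginaryQuadratic K → NumberField.discr K < -4 → SatisfiesHeegnerHypothesis N K →
        (W.quadraticTwist (NumberField.discr K : ℚ)).entireLFunction 1 ≠ 0 →
        WeierstrassCurve.Affine.Point.map ιK.toRatAlgHom P = heegnerPointComplex Dt H →
        ¬ (p : ℤ) ∣ Dt.c → ¬ IsOfFinAddOrder P →
        Odd (NumberField.discr K) →
        ∀ (κ : ZpExtension K p), κ.IsAnticyclotomic →
          ∀ (γ : Field.absoluteGaloisGroup K) [Fact (κ.IsTopGenerator γ)]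
            (𝔭 : HeightOneSpectrum (𝓞 K)), ((p : ℕ) : 𝓞 K) ∈ 𝔭.asIdeal →
            𝔭.asIdeal.ramificationIdx (𝓞 ℚ) = 1 → 𝔭.asIdeal.inertiaDeg (𝓞 ℚ) = 1 →
            ∀ (𝔭bar : HeightOneSpectrum (𝓞 K)), ((p : ℕ) : 𝓞 K) ∈ 𝔭bar.asIdeal → 𝔭bar ≠ 𝔭 →
              ((Ideal.span {(p : ℤ)}).primesOver (𝓞 K)).ncard = 2 →
            ∀ (f : CuspForm (CongruenceSubgroup.Gamma0 N) 2), IsNewformOf W f →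
              ∀ (ι' : PadicAlgCl p ≃+* ℂ),
                (∀ (w : InfinitePlace K) (k : 𝓞 K),
                  k ∈ 𝔭.asIdeal ↔ ‖ι'.symm (w.embedding (k : K))‖ < 1) →
                ∀ (ΩK : ℂ) (Ωp : ℂ_[p]) (Q : PowerSeries 𝓞_ℂ_[p]), ΩK ≠ 0 → ‖Ωp‖ = 1 →
                  R1.IsBDPLFunctionInt p ι' 𝔭 κ γ f ΩK Ωp Q →
                    muInvariant p (XAc (W.baseChange K) p κ 𝔭bar ∅ γ) = 0 →
                      (‖((PowerSeries.coeff (lambdaInvariant p (XAc (W.baseChange K) p κ 𝔭bar ∅ γ)) Q : 𝓞_ℂ_[p]) : ℂ_[p])‖ = 1 ∧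
                      ∀ i < (lambdaInvariant p (XAc (W.baseChange K) p κ 𝔭bar ∅ γ)), ‖((PowerSeries.coeff i Q : 𝓞_ℂ_[p]) : ℂ_[p])‖ < 1) := by
  intro N _ K _ _ Dt H ιK P hc hns hN hK hd4 hHN hLt hP hcM hPinf hodd κ hκ γ _ 𝔭 h𝔭 he hf 𝔭bar h𝔭bar
    hne hsplit f hfW ι' hι' ΩK Ωp Q hΩK hΩp hQ hμ
  obtain ⟨F, hF⟩ :=
    (charIdeal_isPrincipal_holds p (XAc (W.baseChange K) p κ 𝔭bar ∅ γ)).principal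
  have hchar : XAc.charIdeal (W.baseChange K) p κ 𝔭bar ∅ γ = Ideal.span {F} := hF
  have heq := himc N K Dt H ιK P hc hns hN hK hd4 hHN hLt hP hcM hPinf hodd κ hκ γ 𝔭 h𝔭 he
    hf 𝔭bar h𝔭bar hne hsplit f hfW ι' hι' ΩK Ωp Q hΩK hΩp hQ
  unfold R1.IMCEqIntAt at heq
  rw [hchar, Ideal.map_span, Set.image_singleton] at heq
  haveI := module_finite_XAc_baseChange (W := W) p κ 𝔭bar γ
  have htor := (isTorsion_xAc_other_of_cellC hGZK hnf hPT hPT2 hc hK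
        (fun q hq hqp ↦ hHN q hq (hqp.trans (hN ▸
          Summit.BirchSwinnertonDyer.Rank1Residual.X11b.dvd_conductorNorm_of_mult (W := W) hc.2.2.2)))
        hLt P hPinf κ hκ γ 𝔭bar h𝔭bar)
  exact firstUnitCoeff_of_span_singleton_eq heq
    (firstUnitCoeff_map_toCpInt_of_charIdeal_eq_span _ htor hμ hchar)

/-- **c3♭′ at a datum + a first unit coefficient of the frame at `m` ⟹ `μ(X_ac^∅) = 0 ∧ λ(X_ac^∅) = m`**
(analytic `μ = 0` transports to the algebraic side through the ideal equality): §1 in the other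
direction + the dictionary p609918. CONDITIONAL; nothing booked. [claim: KellerYin2024, status: under-review]
[cite: KellerYin2024, Thm. 5.1.3 = Thm. D (arXiv:2402.12781v2) (shape only; nothing asserted)]
[cite: Washington1997, §13.2 and §7.1 Prop. 7.2] -/
theorem invariants_of_imcEq_of_frame_shape
    (hGZK : rank_eq_analyticRank_of_analyticRank_le_one) (hnf : exists_isNewformOf)
    (hPT : ∀ (K : Type) [Field K] [NumberField K], poitouTate_selmerStructure_duality K)
    (hPT2 : ∀ (K : Type) [Field K] [NumberField K], poitouTate_sha_tateDual K)
    (himc : NonsplitIMCEqOnTreeIntOther W p) :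
    ∀ (N : ℕ) [NeZero N] (K : Type) [Field K] [NumberField K] (Dt : ModularParametrizationData W N)
        (H : HeegnerDatum N (NumberField.discr K)) (ιK : K →+* ℂ) (P : (W.baseChange K).toAffine.Point),
        CellC W p → ¬ W.HasSplitMultiplicativeReductionAtPrime p → W.conductorNorm ℤ = N →
        IsImaginaryQuadratic K → NumberField.discr K < -4 → SatisfiesHeegnerHypothesis N K →
        (W.quadraticTwist (NumberField.discr K : ℚ)).entireLFunction 1 ≠ 0 →
        WeierstrassCurve.Affine.Point.map ιK.toRatAlgHom P = heegnerPointComplex Dt H →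
        ¬ (p : ℤ) ∣ Dt.c → ¬ IsOfFinAddOrder P →
        Odd (NumberField.discr K) →
        ∀ (κ : ZpExtension K p), κ.IsAnticyclotomic →
          ∀ (γ : Field.absoluteGaloisGroup K) [Fact (κ.IsTopGenerator γ)]
            (𝔭 : HeightOneSpectrum (𝓞 K)), ((p : ℕ) : 𝓞 K) ∈ 𝔭.asIdeal →
            𝔭.asIdeal.ramificationIdx (𝓞 ℚ) = 1 → 𝔭.asIdeal.inertiaDeg (𝓞 ℚ) = 1 →
            ∀ (𝔭bar : HeightOneSpectrum (𝓞 K)), ((p : ℕ) : 𝓞 K) ∈ 𝔭bar.asIdeal → 𝔭bar ≠ 𝔭 →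
              ((Ideal.span {(p : ℤ)}).primesOver (𝓞 K)).ncard = 2 →
            ∀ (f : CuspForm (CongruenceSubgroup.Gamma0 N) 2), IsNewformOf W f →
              ∀ (ι' : PadicAlgCl p ≃+* ℂ),
                (∀ (w : InfinitePlace K) (k : 𝓞 K),
                  k ∈ 𝔭.asIdeal ↔ ‖ι'.symm (w.embedding (k : K))‖ < 1) →
                ∀ (ΩK : ℂ) (Ωp : ℂ_[p]) (Q : PowerSeries 𝓞_ℂ_[p]), ΩK ≠ 0 → ‖Ωp‖ = 1 →
                  R1.IsBDPLFunctionInt p ι' 𝔭 κ γ f ΩK Ωp Q →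
                    ∀ m : ℕ, (‖((PowerSeries.coeff m Q : 𝓞_ℂ_[p]) : ℂ_[p])‖ = 1 ∧
                      ∀ i < m, ‖((PowerSeries.coeff i Q : 𝓞_ℂ_[p]) : ℂ_[p])‖ < 1) →
                        muInvariant p (XAc (W.baseChange K) p κ 𝔭bar ∅ γ) = 0 ∧ lambdaInvariant p (XAc (W.baseChange K) p κ 𝔭bar ∅ γ) = m := by
  intro N _ K _ _ Dt H ιK P hc hns hN hK hd4 hHN hLt hP hcM hPinf hodd κ hκ γ _ 𝔭 h𝔭 he hf 𝔭bar h𝔭bar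
    hne hsplit f hfW ι' hι' ΩK Ωp Q hΩK hΩp hQ m hQm
  obtain ⟨F, hF⟩ :=
    (charIdeal_isPrincipal_holds p (XAc (W.baseChange K) p κ 𝔭bar ∅ γ)).principal
  have hchar : XAc.charIdeal (W.baseChange K) p κ 𝔭bar ∅ γ = Ideal.span {F} := hF
  have heq := himc N K Dt H ιK P hc hns hN hK hd4 hHN hLt hP hcM hPinf hodd κ hκ γ 𝔭 h𝔭 he
    hf 𝔭bar h𝔭bar hne hsplit f hfW ι' hι' ΩK Ωp Q hΩK hΩp hQ
  unfold R1.IMCEqIntAt at heq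
  rw [hchar, Ideal.map_span, Set.image_singleton] at heq
  haveI := module_finite_XAc_baseChange (W := W) p κ 𝔭bar γ
  have htor := (isTorsion_xAc_other_of_cellC hGZK hnf hPT hPT2 hc hK
        (fun q hq hqp ↦ hHN q hq (hqp.trans (hN ▸
          Summit.BirchSwinnertonDyer.Rank1Residual.X11b.dvd_conductorNorm_of_mult (W := W) hc.2.2.2)))
        hLt P hPinf κ hκ γ 𝔭bar h𝔭bar)
  exact invariants_of_firstUnitCoeff_map_toCpInt _ htor hchar
    (firstUnitCoeff_of_span_singleton_eq heq.symm hQm)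

/-- **D′ at `𝔭̄` (non-split) ⟸ c3♭′ + algebraic `μ = 0`** (+ PUB ×4): `X2.NonsplitMuLambdaOnTreeIntOther W p`
from `X2.NonsplitIMCEqOnTreeIntOther W p` and `μ(X_ac^∅ strict at 𝔭̄) = 0` at every datum — e.g. from
Keller–Yin Thm. D (PRE, by name via p487050) + the `μ`-Lemma for `𝔛_f`. CONDITIONAL; nothing booked.
[claim: KellerYin2024, status: under-review]
[cite: KellerYin2024, Thm. 5.1.3 = Thm. D and §5.1 (the μ-Lemma) (arXiv:2402.12781v2) (shape only; nothing asserted)] -/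
theorem nonsplitMuLambdaOnTreeIntOther_of_imcEq_of_mu_eq_zero
    (hGZK : rank_eq_analyticRank_of_analyticRank_le_one) (hnf : exists_isNewformOf)
    (hPT : ∀ (K : Type) [Field K] [NumberField K], poitouTate_selmerStructure_duality K)
    (hPT2 : ∀ (K : Type) [Field K] [NumberField K], poitouTate_sha_tateDual K)
    (himc : NonsplitIMCEqOnTreeIntOther W p)
    (hμ : ∀ (N : ℕ) [NeZero N] (K : Type) [Field K] [NumberField K] (Dt : ModularParametrizationData W N)
        (H : HeegnerDatum N (NumberField.discr K)) (ιK : K →+* ℂ) (P : (W.baseChange K).toAffine.Point),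
        CellC W p → ¬ W.HasSplitMultiplicativeReductionAtPrime p → W.conductorNorm ℤ = N →
        IsImaginaryQuadratic K → NumberField.discr K < -4 → SatisfiesHeegnerHypothesis N K →
        (W.quadraticTwist (NumberField.discr K : ℚ)).entireLFunction 1 ≠ 0 →
        WeierstrassCurve.Affine.Point.map ιK.toRatAlgHom P = heegnerPointComplex Dt H →
        ¬ (p : ℤ) ∣ Dt.c → ¬ IsOfFinAddOrder P →
        Odd (NumberField.discr K) →
        ∀ (κ : ZpExtension K p), κ.IsAnticyclotomic →
          ∀ (γ : Field.absoluteGaloisGroup K) [Fact (κ.IsTopGenerator γ)]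
            (𝔭 : HeightOneSpectrum (𝓞 K)), ((p : ℕ) : 𝓞 K) ∈ 𝔭.asIdeal →
            𝔭.asIdeal.ramificationIdx (𝓞 ℚ) = 1 → 𝔭.asIdeal.inertiaDeg (𝓞 ℚ) = 1 →
            ∀ (𝔭bar : HeightOneSpectrum (𝓞 K)), ((p : ℕ) : 𝓞 K) ∈ 𝔭bar.asIdeal → 𝔭bar ≠ 𝔭 →
              ((Ideal.span {(p : ℤ)}).primesOver (𝓞 K)).ncard = 2 →
            ∀ (f : CuspForm (CongruenceSubgroup.Gamma0 N) 2), IsNewformOf W f →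
              ∀ (ι' : PadicAlgCl p ≃+* ℂ),
                (∀ (w : InfinitePlace K) (k : 𝓞 K),
                  k ∈ 𝔭.asIdeal ↔ ‖ι'.symm (w.embedding (k : K))‖ < 1) →
                ∀ (ΩK : ℂ) (Ωp : ℂ_[p]) (Q : PowerSeries 𝓞_ℂ_[p]), ΩK ≠ 0 → ‖Ωp‖ = 1 →
                  R1.IsBDPLFunctionInt p ι' 𝔭 κ γ f ΩK Ωp Q →
                    muInvariant p (XAc (W.baseChange K) p κ 𝔭bar ∅ γ) = 0) :
    NonsplitMuLambdaOnTreeIntOther W p :=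
  nonsplitMuLambdaOnTreeIntOther_of_invariants fun N _ K _ _ Dt H ιK P hc hns hN hK hd4 hHN hLt hP hcM hPinf hodd κ hκ γ _ 𝔭 h𝔭 he
      hf 𝔭bar h𝔭bar hne hsplit f hfW ι' hι' ΩK Ωp Q hΩK hΩp hQ ↦
    ⟨(isTorsion_xAc_other_of_cellC hGZK hnf hPT hPT2 hc hK
          (fun q hq hqp ↦ hHN q hq (hqp.trans (hN ▸
            Summit.BirchSwinnertonDyer.Rank1Residual.X11b.dvd_conductorNorm_of_mult (W := W) hc.2.2.2)))
          hLt P hPinf κ hκ γ 𝔭bar h𝔭bar),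
      hμ N K Dt H ιK P hc hns hN hK hd4 hHN hLt hP hcM hPinf hodd κ hκ γ 𝔭 h𝔭 he
        hf 𝔭bar h𝔭bar hne hsplit f hfW ι' hι' ΩK Ωp Q hΩK hΩp hQ,
      frame_shape_of_imcEq_of_mu_eq_zero hGZK hnf hPT hPT2 himc N K Dt H ιK P hc hns hN hK hd4 hHN hLt hP hcM hPinf hodd κ hκ γ 𝔭 h𝔭 he
        hf 𝔭bar h𝔭bar hne hsplit f hfW ι' hι' ΩK Ωp Q hΩK hΩp hQ
        (hμ N K Dt H ιK P hc hns hN hK hd4 hHN hLt hP hcM hPinf hodd κ hκ γ 𝔭 h𝔭 he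
          hf 𝔭bar h𝔭bar hne hsplit f hfW ι' hι' ΩK Ωp Q hΩK hΩp hQ)⟩

/-- **D′ at `𝔭̄` (non-split) ⟸ c3♭′ + analytic `μ = 0`** (+ PUB ×4): `X2.NonsplitMuLambdaOnTreeIntOther W p`
from `X2.NonsplitIMCEqOnTreeIntOther W p` and, at every datum, SOME first unit coefficient of the frame `Q`
(`μ(𝓛^BDP_𝔭) = 0`, e.g. a Hsieh-type analytic `μ`-theorem — nothing taken here). CONDITIONAL; nothing
booked. [claim: KellerYin2024, status: under-review]
[cite: KellerYin2024, Thm. 5.1.3 = Thm. D (arXiv:2402.12781v2) (shape only; nothing asserted)]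
[cite: Hsieh2014, Thm. B (the analytic μ-invariant; context only, nothing asserted)] -/
theorem nonsplitMuLambdaOnTreeIntOther_of_imcEq_of_frame_shape
    (hGZK : rank_eq_analyticRank_of_analyticRank_le_one) (hnf : exists_isNewformOf)
    (hPT : ∀ (K : Type) [Field K] [NumberField K], poitouTate_selmerStructure_duality K)
    (hPT2 : ∀ (K : Type) [Field K] [NumberField K], poitouTate_sha_tateDual K)
    (himc : NonsplitIMCEqOnTreeIntOther W p)
    (hframe : ∀ (N : ℕ) [NeZero N] (K : Type) [Field K] [NumberField K] (Dt : ModularParametrizationData W N)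
        (H : HeegnerDatum N (NumberField.discr K)) (ιK : K →+* ℂ) (P : (W.baseChange K).toAffine.Point),
        CellC W p → ¬ W.HasSplitMultiplicativeReductionAtPrime p → W.conductorNorm ℤ = N →
        IsImaginaryQuadratic K → NumberField.discr K < -4 → SatisfiesHeegnerHypothesis N K →
        (W.quadraticTwist (NumberField.discr K : ℚ)).entireLFunction 1 ≠ 0 →
        WeierstrassCurve.Affine.Point.map ιK.toRatAlgHom P = heegnerPointComplex Dt H →
        ¬ (p : ℤ) ∣ Dt.c → ¬ IsOfFinAddOrder P →
        Odd (NumberField.discr K) →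
        ∀ (κ : ZpExtension K p), κ.IsAnticyclotomic →
          ∀ (γ : Field.absoluteGaloisGroup K) [Fact (κ.IsTopGenerator γ)]
            (𝔭 : HeightOneSpectrum (𝓞 K)), ((p : ℕ) : 𝓞 K) ∈ 𝔭.asIdeal →
            𝔭.asIdeal.ramificationIdx (𝓞 ℚ) = 1 → 𝔭.asIdeal.inertiaDeg (𝓞 ℚ) = 1 →
            ∀ (𝔭bar : HeightOneSpectrum (𝓞 K)), ((p : ℕ) : 𝓞 K) ∈ 𝔭bar.asIdeal → 𝔭bar ≠ 𝔭 →
              ((Ideal.span {(p : ℤ)}).primesOver (𝓞 K)).ncard = 2 →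
            ∀ (f : CuspForm (CongruenceSubgroup.Gamma0 N) 2), IsNewformOf W f →
              ∀ (ι' : PadicAlgCl p ≃+* ℂ),
                (∀ (w : InfinitePlace K) (k : 𝓞 K),
                  k ∈ 𝔭.asIdeal ↔ ‖ι'.symm (w.embedding (k : K))‖ < 1) →
                ∀ (ΩK : ℂ) (Ωp : ℂ_[p]) (Q : PowerSeries 𝓞_ℂ_[p]), ΩK ≠ 0 → ‖Ωp‖ = 1 →
                  R1.IsBDPLFunctionInt p ι' 𝔭 κ γ f ΩK Ωp Q →
                    ∃ m : ℕ, (‖((PowerSeries.coeff m Q : 𝓞_ℂ_[p]) : ℂ_[p])‖ = 1 ∧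
                      ∀ i < m, ‖((PowerSeries.coeff i Q : 𝓞_ℂ_[p]) : ℂ_[p])‖ < 1)) :
    NonsplitMuLambdaOnTreeIntOther W p :=
  nonsplitMuLambdaOnTreeIntOther_of_invariants fun N _ K _ _ Dt H ιK P hc hns hN hK hd4 hHN hLt hP hcM hPinf hodd κ hκ γ _ 𝔭 h𝔭 he
      hf 𝔭bar h𝔭bar hne hsplit f hfW ι' hι' ΩK Ωp Q hΩK hΩp hQ ↦ by
    obtain ⟨m, hQm⟩ := hframe N K Dt H ιK P hc hns hN hK hd4 hHN hLt hP hcM hPinf hodd κ hκ γ 𝔭 h𝔭 he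
      hf 𝔭bar h𝔭bar hne hsplit f hfW ι' hι' ΩK Ωp Q hΩK hΩp hQ
    obtain ⟨hμ, hlam⟩ := invariants_of_imcEq_of_frame_shape hGZK hnf hPT hPT2 himc N K Dt H ιK P hc hns hN hK hd4 hHN hLt hP hcM hPinf hodd κ hκ γ 𝔭 h𝔭 he
      hf 𝔭bar h𝔭bar hne hsplit f hfW ι' hι' ΩK Ωp Q hΩK hΩp hQ m hQm
    exact ⟨(isTorsion_xAc_other_of_cellC hGZK hnf hPT hPT2 hc hK
          (fun q hq hqp ↦ hHN q hq (hqp.trans (hN ▸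
            Summit.BirchSwinnertonDyer.Rank1Residual.X11b.dvd_conductorNorm_of_mult (W := W) hc.2.2.2)))
          hLt P hPinf κ hκ γ 𝔭bar h𝔭bar), hμ, hlam ▸ hQm⟩

end Datum

end Summit.BirchSwinnertonDyer.BirchSwinnertonDyer.Theorems.StubC3InvariantTransfers

end
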